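import Literature.NumberTheory.Automorphic.RestrictedProductBoxes                 -- ★ `boxSubgroup`, `coe_boxSubgroup`
import Literature.MeasureTheory.RestrictedProduct.QuotientMeasureNormalized        -- ★ `rpMeasure_setOf_forall_mem_eq_prod` (Tate's box formula)
import HarnessLib

/-!
# The restricted product measure of a box subgroup: `(∏'_i (m_i ; K_i))(∏_i L_i) = ∏_{i ∈ S} m_i(L_i)`

Topic `NumberTheory/Automorphic` (next to ★ `RestrictedProductBoxes`); namespace `Literature.NumberTheory.Automorphic`.  THEOREMS ONLY (no definition,
no instance, no notation, no named fact, no `sorry`).  Cell `hodgecm-mathlib`, programme P3 «U3-mult», ROAD «TF» (letter #84, residual (A)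
`stub_trace_pureTensor`), brick (M1) of the F0P3a-p07 (g5) brick list v1: the ONE real number through which the box-level operator bricks
(P3)∕(P4) of F0P3-p01 (g11) read the measure — `μ.real (boxSubgroup L) = ∏_{i ∈ S} (m i).real (L i)` — DISCHARGED for Tate's restricted product
measure ★ `rpMeasure (fun i => K_i) m S₀` with `m_i(K_i) = 1` off `S₀ ⊆ S` and `L_i = K_i` off `S` (Tate, in Cassels–Fröhlich Ch. XV §3.3:
«the measure of `∏_{v ∈ S} A_v × ∏_{v ∉ S} 𝒪_v` is `∏_{v∈S} m_v(A_v)`»; Flath 1979 §2 Example 2: the compact open subgroups `K_S′ × K^S`).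
* `rpMeasure_boxSubgroup_eq_prod` — in `ℝ≥0∞`;  * `rpMeasure_real_boxSubgroup_eq_prod` — in `ℝ` (`Measure.real`), over `i ∈ S`;
* `rpMeasure_real_boxSubgroup_eq_prod_coe_sort` — the same over the subtype `i : ↥S`.
All three are ★ `rpMeasure_setOf_forall_mem_eq_prod` read through `coe_boxSubgroup` (`rfl`) and `ENNReal.toReal_prod`.
HONEST LABEL: generic book-keeping; HC_CM is proved only modulo the printed citations until rung 0 closes, and this file moves no count.

## References
* J. W. S. Cassels, A. Fröhlich (eds.), *Algebraic Number Theory* (1967), Ch. XV (J. Tate, *Fourier analysis in number fields and Hecke's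
  zeta-functions*) §3.3 [CasselsFrohlichANT1967].
* D. Flath, *Decomposition of representations into tensor products*, PSPM 33.1 (1979), §2 Example 2 [FlathCorvallis1979].
-/

set_option autoImplicit false

noncomputable section

open MeasureTheory Measure Set
open Literature.MeasureTheory.RestrictedProduct
open scoped RestrictedProduct ENNReal

namespace Literature.NumberTheory.Automorphic

universe u v

variable {ι : Type u} [Countable ι] {G : ι → Type v} [∀ i, Group (G i)] [∀ i, MeasurableSpace (G i)]
  (K : ∀ i, Subgroup (G i)) (m : ∀ i, Measure (G i)) [∀ i, SigmaFinite (m i)]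

/-- **Tate's box formula for a box subgroup**, in `ℝ≥0∞`: for the restricted product measure `∏'_i (m_i ; K_i)` with exceptional set `S₀`
(`m_i(K_i) = 1` off `S₀`), a finite `S ⊇ S₀` and subgroups `L_i` measurable with `L_i = K_i` off `S`:
`(∏'_i (m_i ; K_i))(∏_i L_i) = ∏_{i ∈ S} m_i(L_i)`. [cite: CasselsFrohlichANT1967, Ch. XV (Tate) §3.3] [cite: FlathCorvallis1979, §2 Example 2] -/
theorem rpMeasure_boxSubgroup_eq_prod (hKm : ∀ i, MeasurableSet (K i : Set (G i))) {S₀ : Finset ι}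
    (hm1 : ∀ i, i ∉ S₀ → m i (K i) = 1) {S : Finset ι} (hS : S₀ ⊆ S) (L : ∀ i, Subgroup (G i))
    (hLm : ∀ i, MeasurableSet (L i : Set (G i))) (hLK : ∀ i, i ∉ S → L i = K i) :
    rpMeasure (fun i => (K i : Set (G i))) m S₀ (boxSubgroup (K := K) L : Set (Πʳ i, [G i, K i])) = ∏ i ∈ S, m i (L i) := by
  rw [coe_boxSubgroup]
  exact rpMeasure_setOf_forall_mem_eq_prod (fun i => (K i : Set (G i))) m (fun i => ⟨1, (K i).one_mem⟩) hKm hm1 hS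
    (A := fun i => (L i : Set (G i))) hLm (fun i hi => by rw [hLK i hi])

/-- **Tate's box formula for a box subgroup**, in `ℝ` (`Measure.real`, the currency of ★ `Representation.levelAct`): under the hypotheses of
★ `rpMeasure_boxSubgroup_eq_prod`, `(∏'_i (m_i ; K_i)).real (∏_i L_i) = ∏_{i ∈ S} (m_i).real (L_i)`. [cite: CasselsFrohlichANT1967, Ch. XV (Tate) §3.3]
[cite: FlathCorvallis1979, §2 Example 2] -/
theorem rpMeasure_real_boxSubgroup_eq_prod (hKm : ∀ i, MeasurableSet (K i : Set (G i))) {S₀ : Finset ι}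
    (hm1 : ∀ i, i ∉ S₀ → m i (K i) = 1) {S : Finset ι} (hS : S₀ ⊆ S) (L : ∀ i, Subgroup (G i))
    (hLm : ∀ i, MeasurableSet (L i : Set (G i))) (hLK : ∀ i, i ∉ S → L i = K i) :
    (rpMeasure (fun i => (K i : Set (G i))) m S₀).real (boxSubgroup (K := K) L : Set (Πʳ i, [G i, K i])) = ∏ i ∈ S, (m i).real (L i) := by
  simp only [measureReal_def]
  rw [rpMeasure_boxSubgroup_eq_prod K m hKm hm1 hS L hLm hLK, ENNReal.toReal_prod]

/-- The same over the subtype `i : ↥S` (`Finset.prod_coe_sort`). [cite: CasselsFrohlichANT1967, Ch. XV (Tate) §3.3] [cite: FlathCorvallis1979, §2 Example 2] -/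
theorem rpMeasure_real_boxSubgroup_eq_prod_coe_sort (hKm : ∀ i, MeasurableSet (K i : Set (G i))) {S₀ : Finset ι}
    (hm1 : ∀ i, i ∉ S₀ → m i (K i) = 1) {S : Finset ι} (hS : S₀ ⊆ S) (L : ∀ i, Subgroup (G i))
    (hLm : ∀ i, MeasurableSet (L i : Set (G i))) (hLK : ∀ i, i ∉ S → L i = K i) :
    (rpMeasure (fun i => (K i : Set (G i))) m S₀).real (boxSubgroup (K := K) L : Set (Πʳ i, [G i, K i])) = ∏ i : ↥S, (m i.1).real (L i.1) := by
  rw [rpMeasure_real_boxSubgroup_eq_prod K m hKm hm1 hS L hLm hLK, ← Finset.prod_coe_sort]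

end Literature.NumberTheory.Automorphic

end
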